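import Summits.CriticalPhenomena.PercolationContinuityZ3.Theorems.Transplant.SkelPhiCellsWeakGLevels
import Summits.CriticalPhenomena.PercolationContinuityZ3.Theorems.Transplant.SkelPhiConcReachHab
import HarnessLib

/-!
# N1 (the `{±1}` node), LEVEL 2½, (C) column file (C-R): THE VERTEX-LEVEL ROOMS OF THE N1 SCHEME OF RECORD — the three scheme-specific discharges that
# turn PLANAR containments of the corridor's cores/regions into the vertex-level hypotheses `hM0`, `hreg₁`/`hreg₂`, `hlast₂` of the scheme-generic
# residue `Skelφ.reachOblAtHN_of_chain₂` (`SkelPhiNegReachHabResG`, p279103) at hp-8's scheme `cellGeomSG₂ G ψ P w₀ Λ` (slack far region, weak steps;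
# `SkelPhiCellsWeakG(Levels)`), for ANY reading map:

* `Skelφ.mem_Q_or_Hfull_of_mem_habΩ₂` — a vertex of the fresh habitat `E^{α}_{x,y} ∪ H^{a'}_{y,du}` whose footprint lies in `P.Q y ∪ P.Hfull y du` lies
  in the cube span `Q_α(y)` or in the corridor span (the incoming between-box is planar-disjoint; `du ≠ rev e.2`);
  `Skelφ.mem_Q_union_Efar_of_mem_habΩ₂` — hence in `Q_α(y) ∪ E^far_{a'}(y,du)` (`StepsGeom.Hfull_subset`): the form of `hreg₁`/`hreg₂`.
* `Skelφ.footprint_mem_of_mem_M₂` — `v ∈ M_α(y) ⇒ ψ v ∈ P.M y` (`hM0` from `P.M y ⊆ core 0`).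
* `Skelφ.mem_M_of_mem_habΩ₂` — a vertex of the fresh habitat with footprint in `P.Hfull y du` whose unit box `ψ v ± 1` lies in `P.M (y+du)` lies in
  `M_{a'}(y+du)` (a span neighbour, `Lip`, and the depth room `Λ.ρ a' y du ℓ + 1 ≤ Λ.rM a' (y+du)`): the form of `hlast₂`.

builds on p205010 (kernel theorem, internal audit signed; external expert review pending) — nothing in this file uses p205010; nothing here is a
claim about the open node `SamePDropOfSkeletonNeg`.
Lane `prim-bschramm`, seat `prim-bschramm-p5` (gen 8; (C) lineage); helper file (`--supports stmt-CriticalPhenomena-4575`).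
[cite: KozmaNitzan2024, §4 pp. 25–27 (Q_v, M_v, E_{v,x}, H_{v,x}), p. 30 (Step IV)]
-/

noncomputable section

open scoped Classical

namespace Summit.CriticalPhenomena.PercolationContinuityZ3.Theorems

namespace Transplant

namespace Skelφ

open Literature.Probability.Percolation Literature.Probability.LatticeModels SimpleGraph GadgetSystem Contour KNCells
open Literature.Probability.Percolation.KozmaNitzan
open Literature.Probability.Percolation.KozmaNitzan.Cells (oth sgOf sgOf_sign stepVec_apply_fst)
open Literature.Barriers.CriticalPhenomena (graphBall mem_graphBall_self graphBall_mono)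
open BoxProdZ2 (ConcRadiiG)
open PlanarSkeletonConc (mem_vspan_edgesIn_iff mem_vspan_edgesIn_of_adj)

variable {V : Type} [DecidableEq V] {G : SimpleGraph V} [G.LocallyFinite] {ψ : V → Site 2}

section Rooms

variable {P : PCells2} {w₀ : V} {Λ : ConcRadiiG} {α a' : ℕ} {e : Site 2 × MDir} {du : MDir}

/-- **A vertex of the fresh habitat with footprint in `Q y ∪ H_{y,du}` lies in the cube span `Q_α(y)` or in the corridor span** (the incoming
between-box is planar-disjoint from both) — scheme `cellGeomSG₂`. [folklore] -/
theorem mem_Q_or_Hfull_of_mem_habΩ₂ (hdu : du ≠ rev e.2) {v : V}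
    (hv : v ∈ (cellGeomSG₂ G ψ P w₀ Λ).Ewv α e.1 e.2 ∪ (faceDataSG G ψ P w₀ Λ).Hfull a' (tgt e) du)
    (hψ : ψ v ∈ P.Q (tgt e) ∪ P.Hfull (tgt e) du) :
    v ∈ (cellGeomSG₂ G ψ P w₀ Λ).Q α (tgt e) ∨ v ∈ (faceDataSG G ψ P w₀ Λ).Hfull a' (tgt e) du := by
  rcases Finset.mem_union.1 hv with hv | hv
  · rcases Finset.mem_union.1 hv with hv | hv
    · -- the between-box: planar contradiction
      have hB : ψ v ∈ P.BtwN e.1 e.2 := φ_mem_of_mem_VWin hv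
      exact absurd hψ (Finset.disjoint_left.1 (P.BtwN_disjoint_Q_union_Hfull e.1 e.2 hdu) hB)
    · exact Or.inl hv
  · exact Or.inr hv

/-- **… hence in `Q_α(y) ∪ E^far_{a'}(y,du)`** (`StepsGeom.Hfull_subset`; `a'` an anchor level) — the form of the readings `hreg₁`/`hreg₂` of
`reachOblAtHN_of_chain₂`. [cite: KozmaNitzan2024, §4 p. 30 (Step IV)] -/
theorem mem_Q_union_Efar_of_mem_habΩ₂ (hSt : StepsGeom (cellGeomSG₂ G ψ P w₀ Λ) (faceDataSG G ψ P w₀ Λ))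
    (ha' : a' ∈ (cellGeomSG₂ G ψ P w₀ Λ).anchSet α (tgt e)) (hdu : du ≠ rev e.2) {v : V}
    (hv : v ∈ (cellGeomSG₂ G ψ P w₀ Λ).Ewv α e.1 e.2 ∪ (faceDataSG G ψ P w₀ Λ).Hfull a' (tgt e) du)
    (hψ : ψ v ∈ P.Q (tgt e) ∪ P.Hfull (tgt e) du) :
    v ∈ (cellGeomSG₂ G ψ P w₀ Λ).Q α (tgt e) ∪ (cellGeomSG₂ G ψ P w₀ Λ).Efar a' (tgt e) du := by
  rcases mem_Q_or_Hfull_of_mem_habΩ₂ hdu hv hψ with h | h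
  · exact Finset.mem_union_left _ h
  · exact hSt.Hfull_subset _ _ _ _ ha' h

/-- **The footprint of a vertex of `M_α(y)` lies in `P.M y`** — the form of `hM0` (`P.M y ⊆ core 0`). [folklore] -/
theorem footprint_mem_of_mem_M₂ {y : Site 2} {v : V} (hv : v ∈ (cellGeomSG₂ G ψ P w₀ Λ).M α y) : ψ v ∈ P.M y :=
  φ_mem_of_mem_VWin hv

/-- **A vertex of the corridor span whose unit box lies in `P.M (y+du)` lies in `M_{a'}(y+du)`** (a span neighbour, `Lip`, and the depth room
`Λ.ρ a' y du ℓ + 1 ≤ Λ.rM a' (y+du)`). [cite: KozmaNitzan2024, §4 pp. 26–27] -/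
theorem mem_M_of_mem_Hfull₂ (hlip : Lip G ψ) {y : Site 2} (hρM : ∀ ℓ, Λ.ρ a' y du ℓ + 1 ≤ Λ.rM a' (y + stepVec du)) {v : V}
    (hvH : v ∈ (faceDataSG G ψ P w₀ Λ).Hfull a' y du) (hbox : Finset.Icc (ψ v - 1) (ψ v + 1) ⊆ P.M (y + stepVec du)) :
    v ∈ (cellGeomSG₂ G ψ P w₀ Λ).M a' (y + stepVec du) := by
  have hvM0 : ψ v ∈ P.M (y + stepVec du) := hbox (Finset.mem_Icc.2 ⟨fun i => by simp, fun i => by simp⟩)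
  change v ∈ VStair G ψ w₀ (P.Hfull y du) (prof P Λ a' y du) at hvH
  change v ∈ VWin G ψ w₀ (P.M (y + stepVec du)) (Λ.rM a' (y + stepVec du))
  obtain ⟨z, hz, hvz⟩ := exists_adj_of_mem_VStair hvH
  obtain ⟨-, hdv⟩ := mem_of_mem_VStair hvH
  obtain ⟨-, hdz⟩ := mem_of_mem_VStair hz
  have hψz : ψ z ∈ P.M (y + stepVec du) := by
    refine hbox (Finset.mem_Icc.2 ⟨fun i => ?_, fun i => ?_⟩)
    · have := (abs_le.1 (hlip hvz i)).2; simp only [Pi.sub_apply, Pi.one_apply]; linarith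
    · have := (abs_le.1 (hlip hvz i)).1; simp only [Pi.add_apply, Pi.one_apply]; linarith
  have hvW : v ∈ Win G ψ w₀ (P.M (y + stepVec du)) (Λ.rM a' (y + stepVec du)) :=
    (mem_Win G ψ).2 ⟨graphBall_mono G w₀ (by unfold prof; exact (Nat.le_succ _).trans (hρM _)) hdv, hvM0⟩
  have hzW : z ∈ Win G ψ w₀ (P.M (y + stepVec du)) (Λ.rM a' (y + stepVec du)) :=
    (mem_Win G ψ).2 ⟨graphBall_mono G w₀ (by unfold prof; exact (Nat.le_succ _).trans (hρM _)) hdz, hψz⟩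
  exact (mem_vspan_edgesIn_of_adj hvW hzW hvz).1

/-- **A vertex of the fresh habitat with footprint in `P.Hfull y du` whose unit box lies in `P.M (y+du)` lies in `M_{a'}(y+du)`** — the form of
`hlast₂` of `reachOblAtHN_of_chain₂` (the cube alternative is planar-impossible: `Q y ∩ Q (y+du) = ∅`). [cite: KozmaNitzan2024, §4 pp. 26–27] -/
theorem mem_M_of_mem_habΩ₂ (hlip : Lip G ψ) (hdu : du ≠ rev e.2) (hρM : ∀ ℓ, Λ.ρ a' (tgt e) du ℓ + 1 ≤ Λ.rM a' (tgt e + stepVec du)) {v : V}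
    (hv : v ∈ (cellGeomSG₂ G ψ P w₀ Λ).Ewv α e.1 e.2 ∪ (faceDataSG G ψ P w₀ Λ).Hfull a' (tgt e) du)
    (hH : ψ v ∈ P.Hfull (tgt e) du) (hbox : Finset.Icc (ψ v - 1) (ψ v + 1) ⊆ P.M (tgt e + stepVec du)) :
    v ∈ (cellGeomSG₂ G ψ P w₀ Λ).M a' (tgt e + stepVec du) := by
  rcases mem_Q_or_Hfull_of_mem_habΩ₂ hdu hv (Finset.mem_union_right _ hH) with hvQ | hvHs
  · -- footprint in `P.Q y` and in `P.M (y+du) ⊆ P.Q (y+du)`: impossible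
    have hvM0 : ψ v ∈ P.M (tgt e + stepVec du) := hbox (Finset.mem_Icc.2 ⟨fun i => by simp, fun i => by simp⟩)
    have h1 : ψ v ∈ P.Q (tgt e) := φ_mem_of_mem_VWin hvQ
    have h2 : ψ v ∈ P.Q (tgt e + stepVec du) := P.M_subset_Q _ hvM0
    have hne : tgt e ≠ tgt e + stepVec du := fun h' => by
      have h3 := congrArg (fun z => z du.1) h'
      simp only [Pi.add_apply, stepVec_apply_fst] at h3
      rcases sgOf_sign du with hs | hs <;> rw [hs] at h3 <;> linarith
    exact absurd h2 (Finset.disjoint_left.1 (P.Q_disjoint_Q hne) h1)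
  · exact mem_M_of_mem_Hfull₂ hlip hρM hvHs hbox

end Rooms

end Skelφ

end Transplant

end Summit.CriticalPhenomena.PercolationContinuityZ3.Theorems

end
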